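import Mathlib
import Summits.Ventures.PercRepro2.Defs
import Summits.Ventures.PercRepro2.Independence
import Summits.Ventures.PercRepro2.Harris
import Summits.Ventures.PercRepro2.Graph
import Summits.Ventures.PercRepro2.Events
import Summits.Ventures.PercRepro2.ZCLeafBuilt
import Summits.Ventures.PercRepro2.ZCInsertP

/-!
# (ZC) along a chain of Theorem-G insertions — the `o`-role travelling along a chain
(blind cell PercRepro2, mine-a g24; MINE-A.md §72.9)

A CHAIN is a list of records `(f₁, f₂, v, w)`: the vertex `v` carries the edges `f₁ = va₁` (to the
root) and `f₂ = vw`, and the next record's vertex is this record's `w` (`List.IsChain`).  Starting from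
the marks `(a₁, a₃, o)` with `o = v` of the first record, Theorem G (in its `p`-form) strips the
records one after another — the `o`-role travels along the chain — until the weights
`L.foldl (fun q r => q[r.f₁, r.f₂ ↦ 0]) p` are reached, with the `o`-mark at the last record's `w`.
**Theorem** (`zc_of_o_chain`): if those final weights satisfy (ZC) for the final marks and EVERY
up-set, then (ZC) holds for `p` and the original marks and up-set — the mirror of `zc_of_a3_chain`
(`ZCA3Chain.lean`) with `zc_ow_graph'` supplying the steps.  No definition; one seat.
-/

namespace Summit.Ventures.PercRepro2

section OChain

variable {V : Type*} {E : Type*} [Fintype E] [DecidableEq E] {R : Type*} [CommRing R]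
  [LinearOrder R] [IsStrictOrderedRing R]

/-- **(ZC) along a chain of Theorem-G insertions.** -/
theorem zc_of_o_chain {ends : E → Sym2 V} (a₁ a₃ : V) (L : List (E × E × V × V))
    (hrec : ∀ r ∈ L, ends r.1 = s(r.2.2.1, a₁) ∧ ends r.2.1 = s(r.2.2.1, r.2.2.2) ∧ r.1 ≠ r.2.1
      ∧ r.2.2.1 ≠ a₁ ∧ r.2.2.1 ≠ a₃)
    (hchain : List.IsChain (fun r r' => r.2.2.2 = r'.2.2.1) L)
    (hpair : L.Pairwise (fun r r' => r.2.2.1 ∉ ends r'.1 ∧ r.2.2.1 ∉ ends r'.2.1)) :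
    ∀ (p : E → R), IsProbVec p →
    (∀ r ∈ L, ∀ e, r.2.2.1 ∈ ends e → (∃ r' ∈ L, e = r'.1 ∨ e = r'.2.1) ∨ p e = 0) →
    ∀ (o : V) (𝓔 : Set (Set V)), IsUpperSet 𝓔 → (∀ r, L.head? = some r → r.2.2.1 = o) →
    (∀ 𝓔' : Set (Set V), IsUpperSet 𝓔' →
      let p₀ := L.foldl (fun q r => Function.update (Function.update q r.1 0) r.2.1 0) p
      let o' := L.foldl (fun _ r => r.2.2.2) o
      let e := connEvent ends a₁ a₃
      let L' := connEvent ends a₁ o'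
      let U := clusterInEvent ends a₁ 𝓔'
      let γ := connEvent ends a₃ o'
      0 ≤ prob p₀ (eᶜ ∩ L'ᶜ ∩ γᶜ) * (prob p₀ (U ∩ (e ∩ L')) - prob p₀ U * prob p₀ (e ∩ L'))
        - prob p₀ (eᶜ ∩ L'ᶜ ∩ γ) * (prob p₀ (U ∩ (e ∩ L'ᶜ)) - prob p₀ U * prob p₀ (e ∩ L'ᶜ))) →
    let e := connEvent ends a₁ a₃
    let L' := connEvent ends a₁ o
    let U := clusterInEvent ends a₁ 𝓔
    let γ := connEvent ends a₃ o
    0 ≤ prob p (eᶜ ∩ L'ᶜ ∩ γᶜ) * (prob p (U ∩ (e ∩ L')) - prob p U * prob p (e ∩ L'))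
      - prob p (eᶜ ∩ L'ᶜ ∩ γ) * (prob p (U ∩ (e ∩ L'ᶜ)) - prob p U * prob p (e ∩ L'ᶜ)) := by
  induction L with
  | nil =>
    intro p _ _ o 𝓔 h𝓔 _ hbase
    have h := hbase 𝓔 h𝓔
    simpa using h
  | cons r L ih =>
    intro p hp hzero o 𝓔 h𝓔 hhead hbase
    obtain ⟨f₁, f₂, v, w⟩ := r
    have hv : v = o := hhead (f₁, f₂, v, w) rfl
    subst hv
    obtain ⟨hends₁, hends₂, hf, ho1, ho3⟩ := hrec (f₁, f₂, v, w) List.mem_cons_self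
    simp only at hends₁ hends₂ hf ho1 ho3
    have hrec' : ∀ r ∈ L, ends r.1 = s(r.2.2.1, a₁) ∧ ends r.2.1 = s(r.2.2.1, r.2.2.2) ∧ r.1 ≠ r.2.1
        ∧ r.2.2.1 ≠ a₁ ∧ r.2.2.1 ≠ a₃ := fun r hr => hrec r (List.mem_cons_of_mem _ hr)
    have hchain' : List.IsChain (fun r r' => r.2.2.2 = r'.2.2.1) L := hchain.tail
    have hpair' : L.Pairwise (fun r r' => r.2.2.1 ∉ ends r'.1 ∧ r.2.2.1 ∉ ends r'.2.1) :=
      (List.pairwise_cons.1 hpair).2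
    have hhead' : ∀ r' ∈ L, v ∉ ends r'.1 ∧ v ∉ ends r'.2.1 := (List.pairwise_cons.1 hpair).1
    -- the `p`-form of Theorem G at `v`
    have hmark : ∀ e, v ∈ ends e → e = f₁ ∨ e = f₂ ∨ p e = 0 := by
      intro e he
      rcases hzero (f₁, f₂, v, w) List.mem_cons_self e he with ⟨r', hr', h⟩ | h
      · rcases List.mem_cons.1 hr' with rfl | hr'
        · simp only at h
          rcases h with rfl | rfl
          · exact Or.inl rfl
          · exact Or.inr (Or.inl rfl)
        · exfalso
          rcases h with rfl | rfl
          · exact (hhead' r' hr').1 he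
          · exact (hhead' r' hr').2 he
      · exact Or.inr (Or.inr h)
    simp only
    refine zc_ow_graph' hp hf hends₁ hends₂ hmark ho1 ho3 h𝓔 ?_
    simp only
    -- the inductive hypothesis for the tail, under `p[f₁, f₂ ↦ 0]` and the shifted up-set
    set p' := Function.update (Function.update p f₁ 0) f₂ 0 with hp'def
    have hp' : IsProbVec p' := (hp.update f₁ le_rfl zero_le_one).update f₂ le_rfl zero_le_one
    have hzero' : ∀ r ∈ L, ∀ e, r.2.2.1 ∈ ends e → (∃ r' ∈ L, e = r'.1 ∨ e = r'.2.1) ∨ p' e = 0 := by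
      intro r hr e he
      rcases hzero r (List.mem_cons_of_mem _ hr) e he with ⟨r', hr', h⟩ | h
      · rcases List.mem_cons.1 hr' with rfl | hr'
        · right
          simp only at h
          rcases h with rfl | rfl
          · simp [hp'def, Function.update_of_ne hf]
          · simp [hp'def]
        · exact Or.inl ⟨r', hr', h⟩
      · right
        by_cases h2 : e = f₂
        · subst h2; simp [hp'def]
        · by_cases h1 : e = f₁
          · subst h1; simp [hp'def, Function.update_of_ne h2]
          · rw [hp'def, Function.update_of_ne h2, Function.update_of_ne h1]; exact h
    have hhead'' : ∀ r', L.head? = some r' → r'.2.2.1 = w := by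
      intro r' hr'
      exact ((List.isChain_cons.1 hchain).1 r' hr').symm
    have hbase' : ∀ 𝓔' : Set (Set V), IsUpperSet 𝓔' →
        let p₀ := L.foldl (fun q r => Function.update (Function.update q r.1 0) r.2.1 0) p'
        let o' := L.foldl (fun _ r => r.2.2.2) w
        let e := connEvent ends a₁ a₃
        let L' := connEvent ends a₁ o'
        let U := clusterInEvent ends a₁ 𝓔'
        let γ := connEvent ends a₃ o'
        0 ≤ prob p₀ (eᶜ ∩ L'ᶜ ∩ γᶜ) * (prob p₀ (U ∩ (e ∩ L')) - prob p₀ U * prob p₀ (e ∩ L'))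
          - prob p₀ (eᶜ ∩ L'ᶜ ∩ γ) * (prob p₀ (U ∩ (e ∩ L'ᶜ)) - prob p₀ U * prob p₀ (e ∩ L'ᶜ)) := by
      intro 𝓔' h𝓔'
      have h := hbase 𝓔' h𝓔'
      simp only [List.foldl_cons] at h ⊢
      exact h
    exact ih hrec' hchain' hpair' p' hp' hzero' w _ (isUpperSet_rootShift h𝓔 v) hhead'' hbase'

end OChain

end Summit.Ventures.PercRepro2
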